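import Mathlib
import Summits.AtomisticToContinuum.HydrodynamicLimit.Theorems.JaynesSqueezeEntropicWeakStrongHSGammaA
import Summits.AtomisticToContinuum.HydrodynamicLimit.Theorems.JaynesSqueezeEntropicWeakStrongHSAlgebra2
import Literature.MathematicalPhysics.KineticTheory.HardSphereEulerClassicalUniqueness
import HarnessLib

/-!
# `EntropicWeakStrongHS` (stmt-AtomisticToContinuum-13461), pointwise I: the relative entropy
# density in primitive variables and its coercivity

For a comparison state `V` in the positivity/low-packing region
`Ω = {0 < ρ, ρσ³ < η₀, |m|² < 2ρE}` (primitive variables `r = V₁`, `w = V₂/V₁`, `ϑ = θo(V)`)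
and the classical state `U(τ, x)`: the relative entropy density
`H = h(V) - h(U) - λ·(V - U)` equals
`θ⁻¹ (½ r|w-u|² + 3/2 rθ φ(ϑ/θ) + θρ klFun(r/ρ) + θ Breg_g(r|ρ))`, `g(y) = yF(yσ³)` convex for
small packing; hence on `[0, t] × 𝕋³ × K`, `K ⊆ Ω` compact, `H ≥ c₀ (a² + |b|² + c²)` and
`|V - U|² ≤ C' (a² + |b|² + c²)` with `(a, b, c) = (r - ρ, w - u, ϑ - θ)`.
-/

noncomputable section

open Set Filter MeasureTheory Function InformationTheory
open scoped Topology ContDiff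

namespace Summit.AtomisticToContinuum.HydrodynamicLimit.Theorems.EntropicWeakStrong

open Literature.MathematicalPhysics.KineticTheory Literature.Analysis.FunctionSpaces

/-! ### Primitive variables of a state in the positivity region -/

/-- A state `V` with `V₁ ≠ 0` is the conservative state of its primitive variables
`(V₁, V₂/V₁, θo V)`. -/
theorem consVar_of_prim (θo : (ℝ × V3 × ℝ) → ℝ)
    (hθo : θo = fun U => 2 / 3 * (U.2.2 / U.1 - ‖U.2.1‖ ^ 2 / (2 * U.1 ^ 2)))
    {V : ℝ × V3 × ℝ} (hV1 : V.1 ≠ 0) :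
    V = (V.1, V.1 • (V.1⁻¹ • V.2.1), totalEnergyDensity V.1 (V.1⁻¹ • V.2.1) (θo V)) := by
  obtain ⟨r, m, E⟩ := V
  simp only at hV1 ⊢
  refine Prod.ext rfl (Prod.ext ?_ ?_)
  · simp only [smul_inv_smul₀ hV1]
  · subst hθo
    simp only [totalEnergyDensity, norm_smul, norm_inv, Real.norm_eq_abs, mul_pow, inv_pow, sq_abs]
    field_simp
    ring

/-! ### The relative entropy density along the solution, in primitive variables -/

section Solution

variable {σ T η₀ : ℝ} {F : ℝ → ℝ} {ρ θ : ℝ → T3 → ℝ} {u : ℝ → T3 → V3}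

/-- **The relative entropy density in primitive variables** along the solution. -/
theorem hrel_eq (hE : IsHardSphereEulerSolution σ T ρ u θ) (hσ : 0 < σ)
    (hF : EqOn hsExcessFreeEnergy F (Ico 0 η₀)) (hpack : ∀ t ∈ Ico 0 T, ∀ x, ρ t x * σ ^ 3 < η₀)
    (θo : (ℝ × V3 × ℝ) → ℝ)
    (hθo : θo = fun U => 2 / 3 * (U.2.2 / U.1 - ‖U.2.1‖ ^ 2 / (2 * U.1 ^ 2)))
    (h : (ℝ × V3 × ℝ) → ℝ)
    (hh : h = fun U => -(U.1 * (3 / 2 * Real.log (θo U) - Real.log U.1 -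
      hsExcessFreeEnergy (U.1 * σ ^ 3))))
    (pair : (ℝ × V3 × ℝ) → (ℝ × V3 × ℝ) → ℝ)
    (hpair : pair = fun L U => L.1 * U.1 + (∑ j, L.2.1 j * U.2.1 j) + L.2.2 * U.2.2)
    {τ : ℝ} (hτ : τ ∈ Ico 0 T) (x : T3) {V : ℝ × V3 × ℝ} (hV1 : 0 < V.1)
    (hVp : V.1 * σ ^ 3 < η₀) (hVθ : 0 < θo V) :
    h V - h (ρ τ x, ρ τ x • u τ x, totalEnergyDensity (ρ τ x) (u τ x) (θ τ x)) -
      pair ((-(3 / 2 * Real.log (θ τ x) - Real.log (ρ τ x) - hsExcessFreeEnergy (ρ τ x * σ ^ 3)) +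
        5 / 2 - ‖u τ x‖ ^ 2 / (2 * θ τ x) +
        ρ τ x * σ ^ 3 * deriv hsExcessFreeEnergy (ρ τ x * σ ^ 3) : ℝ),
        (θ τ x)⁻¹ • u τ x, -(θ τ x)⁻¹) (V - (ρ τ x, ρ τ x • u τ x, totalEnergyDensity (ρ τ x) (u τ x) (θ τ x))) =
      (θ τ x)⁻¹ * (1 / 2 * V.1 * ‖V.1⁻¹ • V.2.1 - u τ x‖ ^ 2 +
        3 / 2 * V.1 * θ τ x * ((θo V / θ τ x - 1) - Real.log (θo V / θ τ x)) +
        θ τ x * ρ τ x * klFun (V.1 / ρ τ x) +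
        θ τ x * (V.1 * F (V.1 * σ ^ 3) - ρ τ x * F (ρ τ x * σ ^ 3) -
          (F (ρ τ x * σ ^ 3) + ρ τ x * σ ^ 3 * deriv F (ρ τ x * σ ^ 3)) * (V.1 - ρ τ x))) := by
  have hρ0 := hE.density_pos τ hτ x
  have hθ0 := hE.temperature_pos τ hτ x
  obtain ⟨e1, e2, -⟩ := eos_eqs hF (θ τ x) (packing_mem hE hσ hpack hτ x).1
  have hVmem : V.1 * σ ^ 3 ∈ Ioo 0 η₀ := ⟨mul_pos hV1 (pow_pos hσ 3), hVp⟩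
  obtain ⟨f1, -, -⟩ := eos_eqs hF (θo V) hVmem
  -- rewrite `V` through its primitive variables (keeping `θo V` atomic)
  have hdec := consVar_of_prim θo hθo hV1.ne'
  set r := V.1 with hr
  set w : V3 := V.1⁻¹ • V.2.1 with hw
  set ϑ := θo V with hϑ
  have hV2 : V.2.1 = r • w := by
    have := congrArg (fun W : ℝ × V3 × ℝ => W.2.1) hdec; simpa using this
  have hV3 : V.2.2 = totalEnergyDensity r w ϑ := by
    have := congrArg (fun W : ℝ × V3 × ℝ => W.2.2) hdec; simpa using this
  have hhV : h V = -(r * (3 / 2 * Real.log ϑ - Real.log r - hsExcessFreeEnergy (r * σ ^ 3))) := by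
    rw [hh]
  have hhU : h (ρ τ x, ρ τ x • u τ x, totalEnergyDensity (ρ τ x) (u τ x) (θ τ x)) =
      -(ρ τ x * (3 / 2 * Real.log (θ τ x) - Real.log (ρ τ x) - hsExcessFreeEnergy (ρ τ x * σ ^ 3))) := by
    rw [hh]
    simp only [thetaOf_consVar θo hθo hρ0.ne']
  have hpairV : pair ((-(3 / 2 * Real.log (θ τ x) - Real.log (ρ τ x) -
      hsExcessFreeEnergy (ρ τ x * σ ^ 3)) + 5 / 2 - ‖u τ x‖ ^ 2 / (2 * θ τ x) +
        ρ τ x * σ ^ 3 * deriv hsExcessFreeEnergy (ρ τ x * σ ^ 3) : ℝ),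
        (θ τ x)⁻¹ • u τ x, -(θ τ x)⁻¹)
        (V - (ρ τ x, ρ τ x • u τ x, totalEnergyDensity (ρ τ x) (u τ x) (θ τ x))) =
      (-(3 / 2 * Real.log (θ τ x) - Real.log (ρ τ x) - hsExcessFreeEnergy (ρ τ x * σ ^ 3)) + 5 / 2 -
        ‖u τ x‖ ^ 2 / (2 * θ τ x) + ρ τ x * σ ^ 3 * deriv hsExcessFreeEnergy (ρ τ x * σ ^ 3)) * (r - ρ τ x) +
      (∑ j, ((θ τ x)⁻¹ • u τ x) j * (r • w - ρ τ x • u τ x) j) +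
      (-(θ τ x)⁻¹) * (totalEnergyDensity r w ϑ - totalEnergyDensity (ρ τ x) (u τ x) (θ τ x)) := by
    rw [hpair]
    simp only [Prod.fst_sub, Prod.snd_sub, ← hr, hV2, hV3]
  rw [hhV, hhU, hpairV, e1, e2, f1]
  exact hrel_primitive_form hθ0 hρ0 hV1 hVθ rfl rfl (F (r * σ ^ 3)) (F (ρ τ x * σ ^ 3))
    (ρ τ x * σ ^ 3 * deriv F (ρ τ x * σ ^ 3))

end Solution

/-! ### Convexity of `y ↦ y F(yσ³)` at small packing -/

/-- The Bregman divergence of `g(y) = y F(yσ³)` is non-negative on `(0, η₀σ⁻³)` when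
`2F'(η) + ηF''(η) ≥ 0` on `[0, η₀)` (convexity of the excess free energy density). -/
theorem bregman_nonneg {F : ℝ → ℝ} {η₀ σ : ℝ} (hσ : 0 < σ)
    (hFa : AnalyticOnNhd ℝ F (Ioo (-η₀) η₀))
    (hconv : ∀ η ∈ Ico 0 η₀, 0 ≤ 2 * deriv F η + η * deriv (deriv F) η)
    {r y : ℝ} (hr : 0 < r) (hrp : r * σ ^ 3 < η₀) (hy : 0 < y) (hyp : y * σ ^ 3 < η₀) :
    0 ≤ r * F (r * σ ^ 3) - y * F (y * σ ^ 3) -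
      (F (y * σ ^ 3) + y * σ ^ 3 * deriv F (y * σ ^ 3)) * (r - y) := by
  have hσ3 : 0 < σ ^ 3 := pow_pos hσ 3
  set D : Set ℝ := Ioo 0 (η₀ / σ ^ 3) with hD
  have hmemD : ∀ {z : ℝ}, 0 < z → z * σ ^ 3 < η₀ → z ∈ D := fun hz hzp =>
    ⟨hz, (lt_div_iff₀ hσ3).2 hzp⟩
  have hDpack : ∀ z ∈ D, z * σ ^ 3 ∈ Ioo (-η₀) η₀ ∧ z * σ ^ 3 ∈ Ico 0 η₀ := by
    intro z hz
    have h1 : 0 < z * σ ^ 3 := mul_pos hz.1 hσ3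
    have h2 : z * σ ^ 3 < η₀ := (lt_div_iff₀ hσ3).1 hz.2
    exact ⟨⟨by linarith, h2⟩, ⟨h1.le, h2⟩⟩
  set g : ℝ → ℝ := fun z => z * F (z * σ ^ 3) with hg
  set g' : ℝ → ℝ := fun z => F (z * σ ^ 3) + z * σ ^ 3 * deriv F (z * σ ^ 3) with hg'
  have hgd : ∀ z ∈ D, HasDerivAt g (g' z) z := by
    intro z hz
    have h := (hasDerivAt_id z).mul (hasDerivAt_F_comp hFa (hDpack z hz).1)
    refine h.congr_deriv ?_
    simp only [hg', id]
    ring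
  have hg'd : ∀ z ∈ D, HasDerivAt g' (σ ^ 3 * (2 * deriv F (z * σ ^ 3) +
      z * σ ^ 3 * deriv (deriv F) (z * σ ^ 3))) z := by
    intro z hz
    have h := (hasDerivAt_F_comp hFa (hDpack z hz).1).add (hasDerivAt_mul_derivF_comp hFa (hDpack z hz).1)
    exact h.congr_deriv (by ring)
  -- `g` is convex on `D`
  have hconvex : ConvexOn ℝ D g := by
    have hDo : IsOpen D := isOpen_Ioo
    refine MonotoneOn.convexOn_of_deriv (convex_Ioo _ _)
      (fun z hz => (hgd z hz).continuousAt.continuousWithinAt)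
      (fun z hz => (hgd z (interior_subset hz)).differentiableAt.differentiableWithinAt) ?_
    rw [hDo.interior_eq]
    have hmono : MonotoneOn g' D := by
      refine monotoneOn_of_deriv_nonneg (convex_Ioo _ _)
        (fun z hz => (hg'd z hz).continuousAt.continuousWithinAt)
        (fun z hz => (hg'd z (interior_subset hz)).differentiableAt.differentiableWithinAt) ?_
      rw [hDo.interior_eq]
      intro z hz
      rw [(hg'd z hz).deriv]
      exact mul_nonneg hσ3.le (hconv _ (hDpack z hz).2)
    intro a ha b hb hab
    rw [(hgd a ha).deriv, (hgd b hb).deriv]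
    exact hmono ha hb hab
  -- tangent-line inequality at `y`
  have hyD : y ∈ D := hmemD hy hyp
  have hrD : r ∈ D := hmemD hr hrp
  have hgoal : g y + g' y * (r - y) ≤ g r := by
    rcases lt_trichotomy y r with hlt | heq | hgt
    · have h := hconvex.le_slope_of_hasDerivAt hyD hrD hlt (hgd y hyD)
      rw [slope_def_field, le_div_iff₀ (sub_pos.2 hlt)] at h
      linarith
    · subst heq; simp
    · have h := hconvex.slope_le_of_hasDerivAt hrD hyD hgt (hgd y hyD)
      rw [slope_def_field, div_le_iff₀ (sub_pos.2 hgt)] at h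
      linarith
  simp only [hg, hg'] at hgoal
  linarith

/-! ### Bounds of continuous functions of the comparison state on a compact set -/

/-- A continuous function positive on a compact set is bounded below by a positive constant. -/
theorem exists_pos_lower_bound {K : Set (ℝ × V3 × ℝ)} (hK : IsCompact K) {g : (ℝ × V3 × ℝ) → ℝ}
    (hg : ContinuousOn g K) (hpos : ∀ V ∈ K, 0 < g V) : ∃ m, 0 < m ∧ ∀ V ∈ K, m ≤ g V := by
  by_cases hne : K.Nonempty
  · obtain ⟨V₀, hV₀, hmin⟩ := hK.exists_isMinOn hne hg
    exact ⟨g V₀, hpos V₀ hV₀, fun V hV => hmin hV⟩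
  · exact ⟨1, one_pos, fun V hV => (hne ⟨V, hV⟩).elim⟩

/-- A continuous function on a compact set is bounded above. -/
theorem exists_upper_bound {K : Set (ℝ × V3 × ℝ)} (hK : IsCompact K) {g : (ℝ × V3 × ℝ) → ℝ}
    (hg : ContinuousOn g K) : ∃ M, 0 ≤ M ∧ ∀ V ∈ K, g V ≤ M := by
  obtain ⟨M, hM⟩ := hK.exists_bound_of_continuousOn hg
  refine ⟨max M 0, le_max_right _ _, fun V hV => ?_⟩
  exact ((le_abs_self _).trans ((Real.norm_eq_abs _).symm.le.trans (hM V hV))).trans (le_max_left _ _)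

/-- `θo` is continuous away from `V₁ = 0`. -/
theorem continuousOn_thetaOf (θo : (ℝ × V3 × ℝ) → ℝ)
    (hθo : θo = fun U => 2 / 3 * (U.2.2 / U.1 - ‖U.2.1‖ ^ 2 / (2 * U.1 ^ 2)))
    {K : Set (ℝ × V3 × ℝ)} (hK1 : ∀ V ∈ K, V.1 ≠ 0) : ContinuousOn θo K := by
  subst hθo
  refine ContinuousOn.mul continuousOn_const (ContinuousOn.sub ?_ ?_)
  · exact continuousOn_snd.snd.div continuousOn_fst hK1
  · refine ContinuousOn.div ((continuousOn_snd.fst.norm).pow 2) (continuousOn_const.mul (continuousOn_fst.pow 2)) ?_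
    intro V hV; exact mul_ne_zero two_ne_zero (pow_ne_zero 2 (hK1 V hV))

end Summit.AtomisticToContinuum.HydrodynamicLimit.Theorems.EntropicWeakStrong

end
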